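import Literature.NumberTheory.Transcendental.KZProductIdeal
import Literature.NumberTheory.Transcendental.KZSemiCanonicalReductionProofs
import Literature.NumberTheory.Transcendental.KZLogCalculusProofs
import Literature.NumberTheory.Transcendental.SemialgebraicLineDeriv
import Mathlib.Analysis.Calculus.Deriv.Pow
import Mathlib.Analysis.Calculus.Deriv.Mul
import Mathlib.Analysis.Calculus.FDeriv.Prod

/-!
# `CubeKernelStep` (stmt-KontsevichZagierPeriods-17854), line `Sketch`:
# stub `stub_primitiveCompression`

The RUNG stub `stub_primitiveCompression` (compression of an iterated primitive) of the skeleton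
`Cruxes/CubeKernelStep/Lines/Sketch.lean` of the crux `CubeKernelStep` (route UnfoldedStokes),
UNCONDITIONAL: for `w` continuous and `ℚ`-semialgebraic on `[0,1]` and `k : ℕ`,
`[□², s · (s − s·x)^k · w(s·x)] ≡ [[0,1], (1 − u)^{k+1} w(u) / (k+1)]` modulo `KZ.relations`
(coordinates `s = z 0`, `x = z 1`).

Chain of moves (all over the fixed calculus `KZCalculus.lean`):
* (0) closed square → the band `A = {0 < s < 1, 0 ≤ x ≤ 1}` (null faces `s ∈ {0,1}`,
  `KZ.IntegralRep.of_sub_of_restrict_mem_relations`);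
* (1) rule (2): the fibred shear `(s, x) ↦ (s, s·x)` along the last coordinate over the open base
  `0 < s < 1` (Jacobian `s > 0`), an instance of `KZ.of_sub_of_mem_relations_of_affine`, onto the
  triangle `T = {0 < s < 1, 0 ≤ p ≤ s}` with integrand `(s − p)^k w(p)`;
* (2) rule (2): the coordinate transposition (`KZ.of_sub_of_reindex_mem_relations` with
  `Equiv.swap 0 1`): integrand `(q 1 − q 0)^k w(q 0)` on `{0 < q 1 < 1, 0 ≤ q 0 ≤ q 1}`;
* (3) a null modification (`KZ.of_sub_of_mem_relations_of_null`, hyperplanes `q 0 = 0`, `q 1 = 1`)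
  onto the band `B = {0 < u < 1, u ≤ s ≤ 1}` (`u = q 0`, `s = q 1` last), then ONE Newton–Leibniz
  move (rule (3), `KZ.newtonLeibnizRel`) along `s ∈ [u, 1]` with the polynomial-in-`s` primitive
  `F = (s − u)^{k+1} w(u) / (k+1)`, landing on `[(0,1), F(u,1) − F(u,u)]`;
* (4) a null modification (endpoints) and congruence with `r₁`.
[Kontsevich–Zagier 2001, §1.2 rules (1)–(3)]
-/

noncomputable section

set_option linter.dupNamespace false

namespace Summit.KontsevichZagierPeriods.KontsevichZagierPeriods.Cruxes.CubeKernelStep.Layers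

open MeasureTheory Set
open Literature.ModelTheory.ExponentialFields (IsSemialgebraic)
open Literature.NumberTheory.Transcendental
open Literature.NumberTheory.Transcendental.KZ

/-! ## The given function `w` seen on `ℝ²` through one coordinate -/

/-- `p ↦ w (p j)` is `ℚ`-semialgebraic on every `ℚ`-semialgebraic set whose `j`-th coordinate
stays in `[0,1]` (composition with a polynomial map, Tarski–Seidenberg).
[cite: BochnakCosteRoy1998, Prop. 2.2.6] -/
theorem primComp_semialg_comp {w : (Fin 1 → ℝ) → ℝ}
    (hws : IsSemialgebraicFunOn ℚ (Set.pi Set.univ (fun _ : Fin 1 => Set.Icc (0:ℝ) 1)) w)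
    {s : Set (Fin 2 → ℝ)} (hs : IsSemialgebraic ℚ s) (j : Fin 2)
    (h : ∀ p ∈ s, p j ∈ Set.Icc (0:ℝ) 1) :
    IsSemialgebraicFunOn ℚ s (fun p => w (fun _ : Fin 1 => p j)) := by
  have hmap : IsSemialgebraicMapOn ℚ s (fun (p : Fin 2 → ℝ) (_ : Fin 1) => p j) :=
    (isSemialgebraicMapOn_aeval hs
      (fun _ : Fin 1 => (MvPolynomial.X j : MvPolynomial (Fin 2) ℚ))).congr
      fun p _ => funext fun _ => by simp
  exact IsSemialgebraicFunOn.comp_isSemialgebraicMapOn_holds hws hmap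
    fun p hp => Set.mem_univ_pi.mpr fun _ => h p hp

/-- `p ↦ w (p j)` is continuous where `p j ∈ [0,1]`. [folklore] -/
theorem primComp_continuousOn_comp {w : (Fin 1 → ℝ) → ℝ}
    (hwc : ContinuousOn w (Set.pi Set.univ (fun _ : Fin 1 => Set.Icc (0:ℝ) 1))) (j : Fin 2) :
    ContinuousOn (fun p : Fin 2 → ℝ => w (fun _ : Fin 1 => p j)) {p | p j ∈ Set.Icc (0:ℝ) 1} :=
  hwc.comp (continuous_pi fun _ => continuous_apply j).continuousOn
    fun _ hp => Set.mem_univ_pi.mpr fun _ => hp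

/-! ## The intermediate representations -/

/-- On a `ℚ`-semialgebraic `D ⊆ [0,1]²`, `[D, (p i − p j)^k w(p j)]` is an integral representation
(its integrand is continuous on the compact square). [cite: KontsevichZagier2001, §1.1] -/
theorem primComp_exists_rep (k : ℕ) {w : (Fin 1 → ℝ) → ℝ}
    (hwc : ContinuousOn w (Set.pi Set.univ (fun _ : Fin 1 => Set.Icc (0:ℝ) 1)))
    (hws : IsSemialgebraicFunOn ℚ (Set.pi Set.univ (fun _ : Fin 1 => Set.Icc (0:ℝ) 1)) w)
    {D : Set (Fin 2 → ℝ)} (hD : IsSemialgebraic ℚ D)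
    (hDQ : D ⊆ Set.pi Set.univ (fun _ : Fin 2 => Set.Icc (0:ℝ) 1)) (i j : Fin 2) :
    ∃ R : IntegralRep 2, R.domain = D ∧
      R.integrand = fun p => (p i - p j) ^ k * w (fun _ : Fin 1 => p j) := by
  have hs : IsSemialgebraicFunOn ℚ D (fun p => (p i - p j) ^ k * w (fun _ : Fin 1 => p j)) :=
    (((isSemialgebraicFunOn_apply hD i).fun_sub (isSemialgebraicFunOn_apply hD j)).fun_pow k).fun_mul
      (primComp_semialg_comp hws hD j fun p hp => hDQ hp j (mem_univ _))
  have hc : ContinuousOn (fun p : Fin 2 → ℝ => (p i - p j) ^ k * w (fun _ : Fin 1 => p j))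
      (Set.pi Set.univ (fun _ : Fin 2 => Set.Icc (0:ℝ) 1)) :=
    (((continuous_apply i).sub (continuous_apply j)).pow k).continuousOn.mul
      ((primComp_continuousOn_comp hwc j).mono fun p hp => hp j (mem_univ _))
  exact ⟨⟨D, _, hD, hs,
    (hc.integrableOn_compact (isCompact_univ_pi fun _ => isCompact_Icc)).mono_set hDQ⟩, rfl, rfl⟩

/-- The base representation `[(0,1), F(u,1) − F(u,u)]` of the Newton–Leibniz move, with the
primitive `F q = (q 1 − q 0)^{k+1} w(q 0) / (k+1)`; its integrand is `(1 − u)^{k+1} w(u) / (k+1)`.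
[cite: KontsevichZagier2001, §1.1] -/
theorem primComp_exists_baseRep (k : ℕ) (w : (Fin 1 → ℝ) → ℝ)
    (hwc : ContinuousOn w (Set.pi Set.univ (fun _ : Fin 1 => Set.Icc (0:ℝ) 1)))
    (hws : IsSemialgebraicFunOn ℚ (Set.pi Set.univ (fun _ : Fin 1 => Set.Icc (0:ℝ) 1)) w) :
    ∃ rb : IntegralRep 1,
      rb.domain = {y : Fin 1 → ℝ | 0 < y 0 ∧ y 0 < 1} ∧
      (rb.integrand = fun u =>
        (fun q : Fin 2 → ℝ => (q 1 - q 0) ^ (k + 1) / ((k : ℝ) + 1) * w (fun _ : Fin 1 => q 0))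
            (Fin.snoc u 1) -
          (fun q : Fin 2 → ℝ => (q 1 - q 0) ^ (k + 1) / ((k : ℝ) + 1) * w (fun _ : Fin 1 => q 0))
            (Fin.snoc u (u 0))) ∧
      ∀ u, rb.integrand u = (1 - u 0) ^ (k + 1) / ((k : ℝ) + 1) * w u := by
  have hGs : IsSemialgebraic ℚ {y : Fin 1 → ℝ | 0 < y 0 ∧ y 0 < 1} :=
    isSemialgebraic_unitInterval_fin_one
  have hGQ : {y : Fin 1 → ℝ | 0 < y 0 ∧ y 0 < 1} ⊆
      Set.pi Set.univ (fun _ : Fin 1 => Set.Icc (0:ℝ) 1) :=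
    fun y hy => Set.mem_univ_pi.mpr fun i => by
      rw [Subsingleton.elim i 0]; exact ⟨hy.1.le, hy.2.le⟩
  have hGm : MeasurableSet {y : Fin 1 → ℝ | 0 < y 0 ∧ y 0 < 1} :=
    (isOpen_Ioo.preimage (continuous_apply 0)).measurableSet
  -- coordinates of `Fin.snoc u v : ℝ²`, and the integrand in closed form
  have snoc0 : ∀ (y : Fin 1 → ℝ) (v : ℝ), (Fin.snoc y v : Fin 2 → ℝ) 0 = y 0 := fun _ _ => rfl
  have snoc1 : ∀ (y : Fin 1 → ℝ) (v : ℝ), (Fin.snoc y v : Fin 2 → ℝ) 1 = v := fun _ _ => rfl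
  have hce : ∀ u : Fin 1 → ℝ, (fun _ : Fin 1 => u 0) = u :=
    fun u => funext fun i => congrArg u (Subsingleton.elim 0 i)
  have heq : ∀ u : Fin 1 → ℝ,
      (fun q : Fin 2 → ℝ => (q 1 - q 0) ^ (k + 1) / ((k : ℝ) + 1) * w (fun _ : Fin 1 => q 0))
            (Fin.snoc u 1) -
          (fun q : Fin 2 → ℝ => (q 1 - q 0) ^ (k + 1) / ((k : ℝ) + 1) * w (fun _ : Fin 1 => q 0))
            (Fin.snoc u (u 0)) =
        (1 - u 0) ^ (k + 1) / ((k : ℝ) + 1) * w u := by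
    intro u
    simp only [snoc0, snoc1, sub_self, zero_pow (Nat.succ_ne_zero k), zero_div, zero_mul, sub_zero]
    rw [hce]
  have hc : IsSemialgebraicFunOn ℚ {y : Fin 1 → ℝ | 0 < y 0 ∧ y 0 < 1}
      (fun _ => ((((k : ℚ) + 1)⁻¹ : ℚ) : ℝ)) := isSemialgebraicFunOn_const_ratCast hGs _
  have h1s : IsSemialgebraicFunOn ℚ {y : Fin 1 → ℝ | 0 < y 0 ∧ y 0 < 1} (fun _ => (1:ℝ)) := by
    simpa using isSemialgebraicFunOn_ratCast hGs 1
  have hs : IsSemialgebraicFunOn ℚ {y : Fin 1 → ℝ | 0 < y 0 ∧ y 0 < 1}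
      (fun u => (1 - u 0) ^ (k + 1) / ((k : ℝ) + 1) * w u) := by
    refine ((((h1s.fun_sub (isSemialgebraicFunOn_apply hGs 0)).fun_pow (k + 1)).fun_mul hc).fun_mul
      (hws.mono hGQ hGs)).congr fun u _ => ?_
    push_cast
    ring
  have hcont : ContinuousOn (fun u : Fin 1 → ℝ => (1 - u 0) ^ (k + 1) / ((k : ℝ) + 1) * w u)
      (Set.pi Set.univ (fun _ : Fin 1 => Set.Icc (0:ℝ) 1)) :=
    (((continuous_const.sub (continuous_apply 0)).pow (k + 1)).div_const _).continuousOn.mul hwc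
  have hint : IntegrableOn (fun u : Fin 1 → ℝ => (1 - u 0) ^ (k + 1) / ((k : ℝ) + 1) * w u)
      {y : Fin 1 → ℝ | 0 < y 0 ∧ y 0 < 1} :=
    (hcont.integrableOn_compact (isCompact_univ_pi fun _ => isCompact_Icc)).mono_set hGQ
  exact ⟨⟨_, _, hGs, hs.congr fun u _ => (heq u).symm,
      hint.congr_fun (fun u _ => (heq u).symm) hGm⟩, rfl, rfl, heq⟩

/-! ## The registered stub -/

/-- RUNG (unconditional; VERBATIM the crux-strategist's rung of `Lines/three_sectors.lean`) of
crux `CubeKernelStep`, line `Sketch`: **compression of an iterated primitive.** For `w`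
continuous and `ℚ`-semialgebraic on `[0,1]` and `k : ℕ`, the closed-square representation with
integrand `s · (s − s·x)^k · w(s·x)` (coordinates `s = z 0`, `x = z 1`) is KZ-equivalent to the
closed-interval representation with integrand `(1 − u)^{k+1} · w(u) / (k+1)`. Chain: null faces;
the fibred shear `(s,x) ↦ (s, s x)` (rule (2), Jacobian `s`, `KZ.of_sub_of_mem_relations_of_affine`)
onto `{0 ≤ p ≤ s, 0 < s < 1}` with integrand `(s − p)^k w(p)`; the transposition `(s,p) ↦ (p,s)`
(rule (2), `KZ.of_sub_of_reindex_mem_relations`); null lines; one Newton–Leibniz move along the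
now-last coordinate `s ∈ [u,1]` over the base `u ∈ (0,1)` with the POLYNOMIAL-in-`s` primitive
`(s − u)^{k+1} w(u)/(k+1)` (rule (3)); null endpoints.
[cite: KontsevichZagier2001, §1.2 rules (2), (3)] -/
theorem stub_primitiveCompression :
    ∀ (k : ℕ) (w : (Fin 1 → ℝ) → ℝ),
      ContinuousOn w (Set.pi Set.univ (fun _ : Fin 1 => Set.Icc (0:ℝ) 1)) →
      IsSemialgebraicFunOn ℚ (Set.pi Set.univ (fun _ : Fin 1 => Set.Icc (0:ℝ) 1)) w →
      ∀ (r : IntegralRep 2) (r₁ : IntegralRep 1),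
        r.domain = Set.pi Set.univ (fun _ : Fin 2 => Set.Icc (0:ℝ) 1) →
        Set.EqOn r.integrand
          (fun z => z 0 * (z 0 - z 0 * z 1) ^ k * w (fun _ : Fin 1 => z 0 * z 1)) r.domain →
        r₁.domain = Set.pi Set.univ (fun _ : Fin 1 => Set.Icc (0:ℝ) 1) →
        Set.EqOn r₁.integrand
          (fun u => (1 - u 0) ^ (k + 1) / ((k : ℝ) + 1) * w u) r₁.domain →
        of r - of r₁ ∈ relations := by
  intro k w hwc hws r r₁ hrd hri hr₁d hr₁i
  classical
  -- coordinates of `Fin.snoc y v : ℝ²`; coordinate hyperplanes are null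
  have snoc0 : ∀ (y : Fin 1 → ℝ) (v : ℝ), (Fin.snoc y v : Fin 2 → ℝ) 0 = y 0 := fun _ _ => rfl
  have snoc1 : ∀ (y : Fin 1 → ℝ) (v : ℝ), (Fin.snoc y v : Fin 2 → ℝ) 1 = v := fun _ _ => rfl
  have hplane : ∀ {n : ℕ} (i : Fin n) (c : ℝ), volume {z : Fin n → ℝ | z i = c} = 0 :=
    fun i c => by rw [volume_pi]; exact Measure.pi_hyperplane _ _ _
  -- the open base `G = (0,1) ⊆ ℝ¹`
  have hGs : IsSemialgebraic ℚ {y : Fin 1 → ℝ | 0 < y 0 ∧ y 0 < 1} :=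
    isSemialgebraic_unitInterval_fin_one
  have hGo : IsOpen {y : Fin 1 → ℝ | 0 < y 0 ∧ y 0 < 1} :=
    isOpen_Ioo.preimage (continuous_apply 0)
  have hGQ : {y : Fin 1 → ℝ | 0 < y 0 ∧ y 0 < 1} ⊆
      Set.pi Set.univ (fun _ : Fin 1 => Set.Icc (0:ℝ) 1) :=
    fun y hy => Set.mem_univ_pi.mpr fun i => by
      rw [Subsingleton.elim i 0]; exact ⟨hy.1.le, hy.2.le⟩
  have h0s : IsSemialgebraicFunOn ℚ {y : Fin 1 → ℝ | 0 < y 0 ∧ y 0 < 1} (fun _ => (0:ℝ)) := by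
    simpa using isSemialgebraicFunOn_ratCast hGs 0
  have h1s : IsSemialgebraicFunOn ℚ {y : Fin 1 → ℝ | 0 < y 0 ∧ y 0 < 1} (fun _ => (1:ℝ)) := by
    simpa using isSemialgebraicFunOn_ratCast hGs 1
  have hβs : IsSemialgebraicFunOn ℚ {y : Fin 1 → ℝ | 0 < y 0 ∧ y 0 < 1} (fun y => y 0) :=
    isSemialgebraicFunOn_apply hGs 0
  -- (0) closed square → the band `A` over the open base
  set A : Set (Fin 2 → ℝ) :=
    KZlog.band {y : Fin 1 → ℝ | 0 < y 0 ∧ y 0 < 1} (fun _ => 0) (fun _ => 1) with hA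
  have hmemA : ∀ z : Fin 2 → ℝ, z ∈ A ↔ (0 < z 0 ∧ z 0 < 1) ∧ 0 ≤ z 1 ∧ z 1 ≤ 1 :=
    fun _ => Iff.rfl
  have hAs : IsSemialgebraic ℚ A := KZlog.isSemialgebraic_band h0s h1s
  have hAr : A ⊆ r.domain := by
    intro z hz
    rw [hmemA] at hz
    rw [hrd]
    refine Set.mem_univ_pi.mpr fun i => ?_
    fin_cases i
    · exact ⟨hz.1.1.le, hz.1.2.le⟩
    · exact ⟨hz.2.1, hz.2.2⟩
  have hvol0 : volume (r.domain \ A) = 0 := by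
    refine measure_mono_null (fun z hz => ?_)
      (measure_union_null (hplane (0 : Fin 2) 0)
        (hplane (0 : Fin 2) 1))
    rw [hrd] at hz
    obtain ⟨hzQ, hzA⟩ := hz
    have h0 : z 0 ∈ Set.Icc (0:ℝ) 1 := hzQ 0 (mem_univ _)
    have h1 : z 1 ∈ Set.Icc (0:ℝ) 1 := hzQ 1 (mem_univ _)
    by_contra hne
    simp only [mem_union, mem_setOf_eq, not_or] at hne
    exact hzA ((hmemA z).mpr
      ⟨⟨lt_of_le_of_ne h0.1 (Ne.symm hne.1), lt_of_le_of_ne h0.2 hne.2⟩, h1.1, h1.2⟩)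
  set rA : IntegralRep 2 := r.restrict A hAs hAr with hrA
  have e0 : of r - of rA ∈ relations := r.of_sub_of_restrict_mem_relations hAs hAr hvol0
  -- (1) the fibred shear `(s, x) ↦ (s, s x)` (rule (2))
  have hTs : IsSemialgebraic ℚ
      (KZlog.band {y : Fin 1 → ℝ | 0 < y 0 ∧ y 0 < 1} (fun _ => 0) (fun y => y 0)) :=
    KZlog.isSemialgebraic_band h0s hβs
  have hmemT : ∀ p : Fin 2 → ℝ,
      p ∈ KZlog.band {y : Fin 1 → ℝ | 0 < y 0 ∧ y 0 < 1} (fun _ => 0) (fun y => y 0) ↔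
        (0 < p 0 ∧ p 0 < 1) ∧ 0 ≤ p 1 ∧ p 1 ≤ p 0 := fun _ => Iff.rfl
  have hTQ : KZlog.band {y : Fin 1 → ℝ | 0 < y 0 ∧ y 0 < 1} (fun _ => 0) (fun y => y 0) ⊆
      Set.pi Set.univ (fun _ : Fin 2 => Set.Icc (0:ℝ) 1) := by
    intro p hp
    rw [hmemT] at hp
    refine Set.mem_univ_pi.mpr fun i => ?_
    fin_cases i
    · exact ⟨hp.1.1.le, hp.1.2.le⟩
    · exact ⟨hp.2.1, hp.2.2.trans hp.1.2.le⟩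
  obtain ⟨rT, hrTd, hrTi⟩ := primComp_exists_rep k hwc hws hTs hTQ 0 1
  have e1 : of rA - of rT ∈ relations := by
    refine of_sub_of_mem_relations_of_affine (m := 1) hGo (α := fun _ => 0) (β := fun y => y 0)
      (a := fun _ => 0) (b := fun _ => 1) (a' := fun _ => 0) (b' := fun y => y 0)
      h0s hβs (differentiableOn_const 0) (differentiableOn_apply (𝕜 := ℝ) 0 _)
      (fun y hy => hy.1) rA rT rfl hrTd (fun y _ => by ring) (fun y _ => by ring) ?_
    intro z hz
    have hz' : z ∈ r.domain := hAr hz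
    rw [hrA, IntegralRep.integrand_restrict, hri hz', hrTi]
    simp only [snoc0, snoc1, zero_add, show (Fin.last 1 : Fin 2) = 1 from rfl,
      show Fin.init z 0 = z 0 from rfl]
    ring
  -- (2) the transposition `(s, p) ↦ (p, s)` (rule (2))
  set rR : IntegralRep 2 := rT.reindex (Equiv.swap (0 : Fin 2) 1) with hrR
  have e2 : of rT - of rR ∈ relations := of_sub_of_reindex_mem_relations rT _
  have hmemR : ∀ q : Fin 2 → ℝ, q ∈ rR.domain ↔ (0 < q 1 ∧ q 1 < 1) ∧ 0 ≤ q 0 ∧ q 0 ≤ q 1 := by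
    intro q
    rw [hrR, IntegralRep.reindex_domain, hrTd, mem_setOf_eq, hmemT]
    simp only [Equiv.swap_apply_left, Equiv.swap_apply_right]
  -- (3) null lines, then Newton–Leibniz along the last coordinate (rule (3))
  have hBs : IsSemialgebraic ℚ
      (KZlog.band {y : Fin 1 → ℝ | 0 < y 0 ∧ y 0 < 1} (fun y => y 0) (fun _ => 1)) :=
    KZlog.isSemialgebraic_band hβs h1s
  have hmemB' : ∀ q : Fin 2 → ℝ,
      q ∈ KZlog.band {y : Fin 1 → ℝ | 0 < y 0 ∧ y 0 < 1} (fun y => y 0) (fun _ => 1) ↔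
        (0 < q 0 ∧ q 0 < 1) ∧ q 0 ≤ q 1 ∧ q 1 ≤ 1 := fun _ => Iff.rfl
  have hBQ : KZlog.band {y : Fin 1 → ℝ | 0 < y 0 ∧ y 0 < 1} (fun y => y 0) (fun _ => 1) ⊆
      Set.pi Set.univ (fun _ : Fin 2 => Set.Icc (0:ℝ) 1) := by
    intro q hq
    rw [hmemB'] at hq
    refine Set.mem_univ_pi.mpr fun i => ?_
    fin_cases i
    · exact ⟨hq.1.1.le, hq.1.2.le⟩
    · exact ⟨hq.1.1.le.trans hq.2.1, hq.2.2⟩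
  obtain ⟨rB, hrBd, hrBi⟩ := primComp_exists_rep k hwc hws hBs hBQ 1 0
  have hmemB : ∀ q : Fin 2 → ℝ, q ∈ rB.domain ↔ (0 < q 0 ∧ q 0 < 1) ∧ q 0 ≤ q 1 ∧ q 1 ≤ 1 :=
    fun q => by rw [hrBd]; exact hmemB' q
  have e3 : of rR - of rB ∈ relations := by
    refine of_sub_of_mem_relations_of_null rR rB ?_ ?_ ?_
    · refine measure_mono_null (fun q hq => ?_) (hplane (0 : Fin 2) 0)
      obtain ⟨hqR, hqB⟩ := hq
      rw [hmemR] at hqR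
      by_contra hne
      refine hqB ((hmemB q).mpr ?_)
      have hq0 : 0 < q 0 := lt_of_le_of_ne hqR.2.1 (Ne.symm hne)
      exact ⟨⟨hq0, hqR.2.2.trans_lt hqR.1.2⟩, hqR.2.2, hqR.1.2.le⟩
    · refine measure_mono_null (fun q hq => ?_) (hplane (1 : Fin 2) 1)
      obtain ⟨hqB, hqR⟩ := hq
      rw [hmemB] at hqB
      by_contra hne
      refine hqR ((hmemR q).mpr ?_)
      have hq1 : q 1 < 1 := lt_of_le_of_ne hqB.2.2 hne
      exact ⟨⟨hqB.1.1.trans_le hqB.2.1, hq1⟩, hqB.1.1.le, hqB.2.1⟩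
    · intro q _
      rw [hrR, IntegralRep.reindex_integrand, hrTi, hrBi]
      simp only [Equiv.swap_apply_left, Equiv.swap_apply_right]
  obtain ⟨rb, hrbd, hrbi, hrbc⟩ := primComp_exists_baseRep k w hwc hws
  have e4 : of rB - of rb ∈ relations := by
    have hk : ((k : ℝ) + 1) ≠ 0 := by positivity
    refine newtonLeibnizRel_subset_relations
      ⟨1, rB, rb, fun y => y 0, fun _ => 1,
        fun q : Fin 2 → ℝ => (q 1 - q 0) ^ (k + 1) / ((k : ℝ) + 1) * w (fun _ : Fin 1 => q 0),
        ?_, ?_, ?_, ?_, ?_, ?_, ?_, ?_, rfl⟩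
    · -- the primitive is semialgebraic on the band
      have hRs : IsSemialgebraic ℚ rB.domain := rB.isSemialgebraic_domain
      have hc : IsSemialgebraicFunOn ℚ rB.domain (fun _ => ((((k : ℚ) + 1)⁻¹ : ℚ) : ℝ)) :=
        isSemialgebraicFunOn_const_ratCast hRs _
      have hwB : IsSemialgebraicFunOn ℚ rB.domain (fun q => w (fun _ : Fin 1 => q 0)) :=
        primComp_semialg_comp hws hRs 0 fun q hq =>
          ⟨((hmemB q).mp hq).1.1.le, ((hmemB q).mp hq).1.2.le⟩
      refine (((((isSemialgebraicFunOn_apply hRs 1).fun_sub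
        (isSemialgebraicFunOn_apply hRs 0)).fun_pow (k + 1)).fun_mul hc).fun_mul hwB).congr
        fun q _ => ?_
      push_cast
      ring
    · rw [hrbd]; exact hβs
    · rw [hrbd]; exact h1s
    · intro u hu
      rw [hrbd] at hu
      exact hu.2.le
    · rw [hrBd, hrbd]
      rfl
    · intro u _
      simp only [snoc0, snoc1]
      exact ((((continuous_id.sub continuous_const).pow (k + 1)).div_const ((k : ℝ) + 1)).mul
        continuous_const).continuousOn
    · intro u _ t _
      rw [hrBi]
      simp only [snoc0, snoc1]
      have h := ((((hasDerivAt_id' t).sub_const (u 0)).fun_pow (k + 1)).div_const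
        ((k : ℝ) + 1)).mul_const (w (fun _ : Fin 1 => u 0))
      refine h.congr_deriv ?_
      rw [Nat.add_sub_cancel]
      push_cast
      rw [mul_one, mul_div_cancel_left₀ _ hk]
    · intro u _
      exact congrFun hrbi u
  -- (4) null endpoints and congruence with `r₁`
  have e5 : of rb - of r₁ ∈ relations := by
    refine of_sub_of_mem_relations_of_null rb r₁ ?_ ?_ ?_
    · rw [hrbd, hr₁d, Set.sdiff_eq_empty.mpr hGQ]
      exact measure_empty
    · refine measure_mono_null (fun u hu => ?_)
        (measure_union_null (hplane (0 : Fin 1) 0)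
          (hplane (0 : Fin 1) 1))
      rw [hrbd, hr₁d] at hu
      obtain ⟨huQ, huG⟩ := hu
      have h0 : u 0 ∈ Set.Icc (0:ℝ) 1 := huQ 0 (mem_univ _)
      by_contra hne
      simp only [mem_union, mem_setOf_eq, not_or] at hne
      exact huG ⟨lt_of_le_of_ne h0.1 (Ne.symm hne.1), lt_of_le_of_ne h0.2 hne.2⟩
    · intro u hu
      exact (hrbc u).trans (hr₁i hu.2).symm
  have key : of r - of r₁ =
      (of r - of rA) + (of rA - of rT) + (of rT - of rR) + (of rR - of rB) + (of rB - of rb) +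
        (of rb - of r₁) := by abel
  rw [key]
  exact relations.add_mem (relations.add_mem (relations.add_mem (relations.add_mem
    (relations.add_mem e0 e1) e2) e3) e4) e5

end Summit.KontsevichZagierPeriods.KontsevichZagierPeriods.Cruxes.CubeKernelStep.Layers

end
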